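import Mathlib
import Summits.Ventures.PercRepro2.SepThreeGcZero
import Summits.Ventures.PercRepro2.MixChordOSeparatedAll

/-!
# The `o`-class chord on typer-1's (SEP-3) zero classes (blind cell PercRepro2, night-1 g23;
proofs/NIGHT1-G23.md §7)

On the classes where `Gc` vanishes identically for every weight vector — `{a₁, a₃}` cuts `o` off from
`a₂` and `b` (`SepThreeGcZero.Gc_eq_zero_of_sepThree`), or its mirror `{a₂, a₃}` cuts `o` off from `a₁`
and `b` — every chord is trivial (`Sep.dChord_of_Gc_eq_zero`; the class is a property of `ends`, so it
holds at both pins of the `o`-edge).  Hence the `o`-class `D`-chord with any normaliser, along any edge: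
**`dChord_of_sepThree`**, **`dChord_of_sepThree'`**, and the chain's rows.  Own code; standard axioms.
-/

namespace Summit.Ventures.PercRepro2

open UnionCluster CovForm SepThreeGcZero SepPair

namespace Mix

namespace Sep

section SepThree

variable {V : Type*} {E : Type*} [Fintype E] [DecidableEq E]
  {R : Type*} [Field R] [LinearOrder R] [IsStrictOrderedRing R]

variable (p : E → R) (ends : E → Sym2 V) {o a₁ a₂ a₃ b : V} (f : E)

/-- **The chord on the (SEP-3) class** (`{a₁, a₃}` cuts `o` off from `a₂` and `b`), any normaliser, any
edge. -/
theorem dChord_of_sepThree (N : (E → R) → R) (hp : IsProbVec p) (ho : o ∉ ({a₁, a₃} : Set V))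
    (h₂ : a₂ ∉ cluster ends (sepConfig ends {a₁, a₃}) o ∪ {a₁, a₃})
    (hb : b ∉ cluster ends (sepConfig ends {a₁, a₃}) o) :
    NMixChord N p ends o a₁ a₂ a₃ b f :=
  dChord_of_Gc_eq_zero p ends o a₁ a₂ a₃ b f N (Gc_eq_zero_of_sepThree hp ends ho h₂ hb)
    (Gc_eq_zero_of_sepThree (hp.update f le_rfl zero_le_one) ends ho h₂ hb)
    (Gc_eq_zero_of_sepThree (hp.update f zero_le_one le_rfl) ends ho h₂ hb)

/-- **The chord on the mirror (SEP-3) class** (`{a₂, a₃}` cuts `o` off from `a₁` and `b`). -/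
theorem dChord_of_sepThree' (N : (E → R) → R) (hp : IsProbVec p) (ho : o ∉ ({a₂, a₃} : Set V))
    (h₁ : a₁ ∉ cluster ends (sepConfig ends {a₂, a₃}) o ∪ {a₂, a₃})
    (hb : b ∉ cluster ends (sepConfig ends {a₂, a₃}) o) :
    NMixChord N p ends o a₁ a₂ a₃ b f :=
  dChord_of_Gc_eq_zero p ends o a₁ a₂ a₃ b f N (Gc_eq_zero_of_sepThree' hp ends ho h₁ hb)
    (Gc_eq_zero_of_sepThree' (hp.update f le_rfl zero_le_one) ends ho h₁ hb)
    (Gc_eq_zero_of_sepThree' (hp.update f zero_le_one le_rfl) ends ho h₁ hb)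

/-- The chain's row on the (SEP-3) class. -/
theorem dz2Chord_of_sepThree (hp : IsProbVec p) (ho : o ∉ ({a₁, a₃} : Set V))
    (h₂ : a₂ ∉ cluster ends (sepConfig ends {a₁, a₃}) o ∪ {a₁, a₃})
    (hb : b ∉ cluster ends (sepConfig ends {a₁, a₃}) o) :
    NMixChord (normDZ2 ends a₁ a₂ a₃) p ends o a₁ a₂ a₃ b f :=
  dChord_of_sepThree p ends f _ hp ho h₂ hb

/-- The chain's row on the mirror (SEP-3) class. -/
theorem dz2Chord_of_sepThree' (hp : IsProbVec p) (ho : o ∉ ({a₂, a₃} : Set V))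
    (h₁ : a₁ ∉ cluster ends (sepConfig ends {a₂, a₃}) o ∪ {a₂, a₃})
    (hb : b ∉ cluster ends (sepConfig ends {a₂, a₃}) o) :
    NMixChord (normDZ2 ends a₁ a₂ a₃) p ends o a₁ a₂ a₃ b f :=
  dChord_of_sepThree' p ends f _ hp ho h₁ hb

end SepThree

end Sep

end Mix

end Summit.Ventures.PercRepro2
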